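import Literature.AlgebraicGeometry.Milne1999.SpecialLefschetzGroupInvariantsProducts
import Literature.AlgebraicGeometry.Milne1999.SpecialLefschetzGroupInvariantsCMProducts
import Literature.AlgebraicGeometry.Motives.AbelianVarietyEndAlgebraOrthogonalBiproduct
import HarnessLib

/-!
# Milne 1999, Prop. 3.4 (start of proof): the `S`-invariants of an abelian variety isogenous to a finite
# product `A₁ × ⋯ × A_s` of pairwise `Hom`-orthogonal factors are Lefschetz classes as soon as they are so
# on the factors ("by 3.1 and induction"), and the transport of this property along isogenies

Family `hodge`, layer `Literature/AlgebraicGeometry/Milne1999`, namespace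
`Literature.AlgebraicGeometry.Milne1999` (D-0022). THEOREMS ONLY (no definition, no named fact, no `sorry`;
D-0026, net debt 0). Written for the cell `pub-hodgecm2` (COR-CM), seat `lit-milne`, binder table
`HOME/lit/milne.md` (rows M2/M4: the record `Milne1999_specialLefschetzGroup_invariants_le`, i.e. Cor. 4.5 with
Thm. 4.4 and Thm. 3.2, whose conclusion is proved here on new loci). Sequel of
`Milne1999/SpecialLefschetzGroupInvariantsProducts` (the binary case `B × C`).

## Source, verbatim

J. S. Milne, *Lefschetz classes on abelian varieties*, Duke Math. J. 96 (1999) 639–675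
[`paper:doi-10-1215-s0012-7094-99-09620-5`, held; PDF page = printed page − 638], p. 654 (p0016 L13–L24):
"Start of the proof of Proposition 3.4. It follows from Proposition 1.5 that `S(A) = S(A^r)`, and so it
suffices to prove the statement with `r = 1`. Moreover, an isogeny `A → A₁^{r₁} × ⋯ × A_s^{r_s}` with the
`Aᵢ` simple and pairwise nonisogenous defines isomorphisms `H*(A) → H*(A₁^{r₁}) ⊗ ⋯ ⊗ H*(A_s^{r_s})`,
`S(A) → S(A₁) × ⋯ × S(A_s)` (see 1.5) and hence (by 3.1 and induction) an isomorphism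
`H*(A)^{S(A)} → H*(A₁^{r₁})^{S(A₁)} ⊗ ⋯ ⊗ H*(A_s^{r_s})^{S(A_s)}`. If the proposition is true for each variety
`Aᵢ^{rᵢ}` […] then it is clear that it is also true for `A`."  And §1 p. 644 (p0006): "Clearly `S(A)`
depends only on the isogeny class of `A`."

## What is here (the tree's carriers: `ℂ`-points, Betti cohomology, `S(A)(ℂ) = unitaryCentralizerGroup A h`)

Throughout, the **polarization package** of a complex abelian variety `B` is the datum the tree's Thm. 4.4
(`exteriorPullbackEquiv_mem_specialLefschetzGroup`) consumes together with the `S(B)(ℂ)`-form of the record: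
a class `D ∈ B¹(B) ⊗ ℂ` with `D^{dim B} ≠ 0`, `Q_D` non-degenerate on `H¹(B)`, such that every class of
`H^{2p}(B(ℂ); ℂ)` fixed by `⋀^{2p}u` for all `u ∈ S(B)(ℂ)` (for `D`) lies in `Dᵖ(B) ⊗ ℂ` (spelled out in
each statement; no abbreviation is introduced).

* §1 **Transport along an isogeny `f : A ⟶ B`** (`u ↦ f^* ∘ u ∘ (f^*)⁻¹`, the tree's `isogenyConj`,
  `isogenyConj_mem_unitaryCentralizerGroup_iff`): the `S(ℂ)`-form for `(B, D)` gives the `S(ℂ)`-form for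
  `(A, f^*D)` (`mem_divisorClassesSpan_of_isIsogeny_of_forall_exteriorPullback_eq`); packages pull back
  (`exists_polarization_invariants_le_of_isIsogeny`, both directions of `IsIsogenous`); a package gives the
  record (`specialLefschetzGroup_invariants_le_of_exists_polarization_invariants_le`).
* §2 **The finite product** `⨁_{i : Fin (n+1)} Aᵢ` (Mathlib's biproduct in the preadditive category of complex
  abelian varieties, the carrier of the tree's `LefschetzCentraliserBiproducts`) of pairwise `Hom`-orthogonal
  positive-dimensional factors: by induction along `⨁_{Fin (n+1)} A ≅ A 0 × ⨁_{Fin n} (A ∘ succ)`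
  (`biproductSuccSplit`, an isogeny) from the binary theorem
  `mem_divisorClassesSpan_prod_of_forall_exteriorPullback_eq` (Lemma 3.1 twice) and §1, the `S(ℂ)`-forms of
  the factors for classes `hᵢ` give the `S(ℂ)`-form of `⨁ A` for Milne's product divisor class `Σ πᵢ^* hᵢ`
  (`sumPolarizationClass`); packages of the factors give a package of `⨁ A`, the record for `⨁ A`, and the
  record for EVERY `X` isogenous to `⨁ A` (Cor. 4.5 as a set equality and Prop. 4.8 (c) ⇒ (a) follow).
* §3 **Packages of the known factors**: `End(B)` commutative (the tree's torus argument,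
  `mem_divisorClassesSpan_of_forall_exteriorPullback_eq_of_forall_comp_comm`), `B(B) = D(B)`
  (`…_of_isDivisorGenerated`: `dim ≤ 3`, products of elliptic curves, …), powers `X^{N+1}` of a simple CM
  abelian variety (the tree's Lemma 3.8 with multiplicities, `exists_polarization_invariants_le_biproduct_of_classes`),
  and the binary product of two packages.
* §4 **New loci of the record**, hypotheses closed: every complex abelian variety isogenous to a finite product
  of pairwise `Hom`-orthogonal positive-dimensional factors each of which has commutative `End` or `B = D`
  (e.g. pairwise non-isogenous simple factors of type I, of type IV with `d = 1`, or of dimension `≤ 3`,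
  WITHOUT the multiplicity-one factors having to be of the same kind), or is a power of a simple CM abelian
  variety.

## What is NOT here

The isotypic components `Aᵢ^{rᵢ}` with `rᵢ ≥ 2` and `Aᵢ` not of CM type, and the simple factors of types
II, III and IV with `d ≥ 2`: there the `S(ℂ)`-form needs Milne's Prop. 3.6 / 3.7 (first fundamental theorems
for `Sp`, `O`, `GL` with multiplicities), which the tree does not have; the record
`Milne1999_specialLefschetzGroup_invariants_le` itself is NOT discharged.

## References

* [Milne1999LefschetzClasses] J. S. Milne, Lefschetz classes on abelian varieties, Duke Math. J. 96 (1999)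
  639–675: §1 pp. 643–644, Prop. 1.1, Prop. 1.5, Lemma 3.1, Thm. 3.2, Prop. 3.4 (start of proof, p. 654),
  Lemma 3.8, Thm. 4.4, Cor. 4.5 (p. 659), Prop. 4.8 (p. 660).
* [MumfordAV1970] D. Mumford, Abelian Varieties, §19 Thm. 1, Cor. 1–2 (pp. 173–174) (Poincaré reducibility,
  `Hom` between simple abelian varieties).
* [vanGeemen1994HodgeAV] B. van Geemen, An introduction to the Hodge conjecture for abelian varieties,
  LNM 1594 (1994), §2.4–2.5 and §3.6 (isogeny invariance of `B` and `D`).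
* [HatcherAT2002] A. Hatcher, Algebraic Topology, §3.2 Prop. 3.10, Thm. 3.16.
-/

noncomputable section

open CategoryTheory CategoryTheory.Limits
open Literature.AlgebraicTopology.SingularHomology
open Literature.AlgebraicGeometry.HodgeTheory
open Literature.AlgebraicGeometry.Motives
open Literature.AlgebraicGeometry.VanGeemen1994 (hodgeClassSpan)
open Literature.AlgebraicGeometry.Pohlmann1968 (isIsogenous_powSucc isIsogenous_powSucc_biproduct)
open Literature.Barriers.HodgeConjecture (divisorClassesSpan)
open Literature.Geometry.Kaehler (lefschetzPow)

namespace Literature.AlgebraicGeometry.Milne1999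

/-! ### §1 Transport of the `S(ℂ)`-form and of polarization packages along an isogeny -/

section Transport

variable {A B : AbelianVariety ℂ} {f : A ⟶ B}

/-- **"`S(A)` depends only on the isogeny class of `A`" (§1 p. 644), for the `S(ℂ)`-form of Cor. 4.5**: for an
isogeny `f : A ⟶ B` and any class `D ∈ H²(B(ℂ); ℂ)`, if every class of `H^{2a}(B(ℂ); ℂ)` fixed by `⋀^{2a}u`
for all `u ∈ S(B)(ℂ)` (for `D`) lies in `Dᵃ(B) ⊗ ℂ`, then every class `x ∈ H^{2p}(A(ℂ); ℂ)` fixed by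
`⋀^{2p}v` for all `v ∈ S(A)(ℂ)` (for `f^*D`) lies in `Dᵖ(A) ⊗ ℂ`: `f^* ∘ u ∘ (f^*)⁻¹ ∈ S(A)(ℂ)`
(`isogenyConj_mem_unitaryCentralizerGroup_iff`), so `⋀u` fixes `y = ⋀((f^*)⁻¹) x`, and
`x = f^* y ∈ f^*(Dᵖ(B) ⊗ ℂ) = Dᵖ(A) ⊗ ℂ` (`divisorClassesSpan_map_eq_of_isIsogeny`).
[cite: Milne1999LefschetzClasses, §1 p. 644 and Prop. 3.4 (start of proof, p. 654)]
[cite: vanGeemen1994HodgeAV, §2.4 and §3.6 (p. 236)] -/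
theorem mem_divisorClassesSpan_of_isIsogeny_of_forall_exteriorPullback_eq (hf : AbelianVariety.IsIsogeny f)
    {D : complexBetti B.X 2}
    (hB : ∀ (a : ℕ) (y : complexBetti B.X (2 * a)), (∀ u ∈ unitaryCentralizerGroup B D,
      exteriorPullback (AbelianVariety.hasExteriorCohomologyH1_complexPoints B)
        (u : complexBetti B.X 1 →ₗ[ℂ] complexBetti B.X 1) (2 * a) y = y) → y ∈ divisorClassesSpan B.X B.dim a)
    (p : ℕ) (x : complexBetti A.X (2 * p))
    (hx : ∀ v ∈ unitaryCentralizerGroup A (complexBetti.map f.hom.hom.hom 2 D),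
      exteriorPullback (AbelianVariety.hasExteriorCohomologyH1_complexPoints A)
        (v : complexBetti A.X 1 →ₗ[ℂ] complexBetti A.X 1) (2 * p) x = x) :
    x ∈ divisorClassesSpan A.X A.dim p := by
  have hy : ∀ u ∈ unitaryCentralizerGroup B D,
      exteriorPullback (AbelianVariety.hasExteriorCohomologyH1_complexPoints B)
        (u : complexBetti B.X 1 →ₗ[ℂ] complexBetti B.X 1) (2 * p)
        (exteriorPullback (AbelianVariety.hasExteriorCohomologyH1_complexPoints A)
          ((isogenyPullbackOne hf).symm : complexBetti A.X 1 →ₗ[ℂ] complexBetti B.X 1) (2 * p) x) =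
      exteriorPullback (AbelianVariety.hasExteriorCohomologyH1_complexPoints A)
        ((isogenyPullbackOne hf).symm : complexBetti A.X 1 →ₗ[ℂ] complexBetti B.X 1) (2 * p) x :=
    fun u hu ↦ exteriorPullback_apply_eq_self_of_isogenyConj hf u (2 * p)
      (hx _ ((isogenyConj_mem_unitaryCentralizerGroup_iff hf D).2 hu))
  rw [← map_exteriorPullback_isogenyPullbackOne_symm hf (2 * p) x, ← divisorClassesSpan_map_eq_of_isIsogeny hf p]
  exact Submodule.mem_map_of_mem (hB p _ hy)

/-- **Polarization packages pull back along isogenies**: if `f : A ⟶ B` is an isogeny and `B` carries a class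
`D ∈ B¹(B) ⊗ ℂ` with `D^{dim B} ≠ 0`, `Q_D` non-degenerate on `H¹(B)` and the `S(B)(ℂ)`-form of Cor. 4.5, then
`f^*D` is such a class on `A` (`polarization_hypotheses_map` for the three polarization hypotheses, and
`mem_divisorClassesSpan_of_isIsogeny_of_forall_exteriorPullback_eq`).
[cite: Milne1999LefschetzClasses, §1 p. 644, Prop. 3.4 (p. 654), Thm. 4.4 (proof, p. 659)] -/
theorem exists_polarization_invariants_le_of_isIsogeny (hf : AbelianVariety.IsIsogeny f)
    (hB : ∃ D : complexBetti B.X 2, D ∈ hodgeClassSpan B.dim B.X 1 ∧ lefschetzPow D (B.dim - 1) 2 D ≠ 0 ∧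
      (∀ z : complexBetti B.X 1, (∀ y, polarizationPairingOne B.X D (B.dim - 1) z y = 0) → z = 0) ∧
      ∀ (a : ℕ) (y : complexBetti B.X (2 * a)), (∀ u ∈ unitaryCentralizerGroup B D,
        exteriorPullback (AbelianVariety.hasExteriorCohomologyH1_complexPoints B)
          (u : complexBetti B.X 1 →ₗ[ℂ] complexBetti B.X 1) (2 * a) y = y) → y ∈ divisorClassesSpan B.X B.dim a) :
    ∃ D : complexBetti A.X 2, D ∈ hodgeClassSpan A.dim A.X 1 ∧ lefschetzPow D (A.dim - 1) 2 D ≠ 0 ∧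
      (∀ z : complexBetti A.X 1, (∀ y, polarizationPairingOne A.X D (A.dim - 1) z y = 0) → z = 0) ∧
      ∀ (a : ℕ) (y : complexBetti A.X (2 * a)), (∀ u ∈ unitaryCentralizerGroup A D,
        exteriorPullback (AbelianVariety.hasExteriorCohomologyH1_complexPoints A)
          (u : complexBetti A.X 1 →ₗ[ℂ] complexBetti A.X 1) (2 * a) y = y) → y ∈ divisorClassesSpan A.X A.dim a := by
  obtain ⟨D, hh, htop, hnd, rec⟩ := hB
  obtain ⟨hh', htop', hnd'⟩ := polarization_hypotheses_map hf hh htop hnd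
  exact ⟨_, hh', htop', hnd', mem_divisorClassesSpan_of_isIsogeny_of_forall_exteriorPullback_eq hf rec⟩

/-- Polarization packages are inherited from anything one is isogenous ONTO (`IsIsogenous A B`:
`∃ f : A ⟶ B` an isogeny). [cite: Milne1999LefschetzClasses, §1 p. 644] -/
theorem exists_polarization_invariants_le_of_isIsogenous (hAB : AbelianVariety.IsIsogenous A B)
    (hB : ∃ D : complexBetti B.X 2, D ∈ hodgeClassSpan B.dim B.X 1 ∧ lefschetzPow D (B.dim - 1) 2 D ≠ 0 ∧
      (∀ z : complexBetti B.X 1, (∀ y, polarizationPairingOne B.X D (B.dim - 1) z y = 0) → z = 0) ∧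
      ∀ (a : ℕ) (y : complexBetti B.X (2 * a)), (∀ u ∈ unitaryCentralizerGroup B D,
        exteriorPullback (AbelianVariety.hasExteriorCohomologyH1_complexPoints B)
          (u : complexBetti B.X 1 →ₗ[ℂ] complexBetti B.X 1) (2 * a) y = y) → y ∈ divisorClassesSpan B.X B.dim a) :
    ∃ D : complexBetti A.X 2, D ∈ hodgeClassSpan A.dim A.X 1 ∧ lefschetzPow D (A.dim - 1) 2 D ≠ 0 ∧
      (∀ z : complexBetti A.X 1, (∀ y, polarizationPairingOne A.X D (A.dim - 1) z y = 0) → z = 0) ∧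
      ∀ (a : ℕ) (y : complexBetti A.X (2 * a)), (∀ u ∈ unitaryCentralizerGroup A D,
        exteriorPullback (AbelianVariety.hasExteriorCohomologyH1_complexPoints A)
          (u : complexBetti A.X 1 →ₗ[ℂ] complexBetti A.X 1) (2 * a) y = y) → y ∈ divisorClassesSpan A.X A.dim a := by
  obtain ⟨f, hf⟩ := hAB
  exact exists_polarization_invariants_le_of_isIsogeny hf hB

/-- Polarization packages are inherited from anything isogenous onto one (the isogeny relation is symmetric,
`AbelianVariety.IsIsogenous.symm'`). [cite: Milne1999LefschetzClasses, §1 p. 644] [cite: MumfordAV1970, §19 Remark p. 169] -/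
theorem exists_polarization_invariants_le_of_isIsogenous' (hBA : AbelianVariety.IsIsogenous B A)
    (hB : ∃ D : complexBetti B.X 2, D ∈ hodgeClassSpan B.dim B.X 1 ∧ lefschetzPow D (B.dim - 1) 2 D ≠ 0 ∧
      (∀ z : complexBetti B.X 1, (∀ y, polarizationPairingOne B.X D (B.dim - 1) z y = 0) → z = 0) ∧
      ∀ (a : ℕ) (y : complexBetti B.X (2 * a)), (∀ u ∈ unitaryCentralizerGroup B D,
        exteriorPullback (AbelianVariety.hasExteriorCohomologyH1_complexPoints B)
          (u : complexBetti B.X 1 →ₗ[ℂ] complexBetti B.X 1) (2 * a) y = y) → y ∈ divisorClassesSpan B.X B.dim a) :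
    ∃ D : complexBetti A.X 2, D ∈ hodgeClassSpan A.dim A.X 1 ∧ lefschetzPow D (A.dim - 1) 2 D ≠ 0 ∧
      (∀ z : complexBetti A.X 1, (∀ y, polarizationPairingOne A.X D (A.dim - 1) z y = 0) → z = 0) ∧
      ∀ (a : ℕ) (y : complexBetti A.X (2 * a)), (∀ u ∈ unitaryCentralizerGroup A D,
        exteriorPullback (AbelianVariety.hasExteriorCohomologyH1_complexPoints A)
          (u : complexBetti A.X 1 →ₗ[ℂ] complexBetti A.X 1) (2 * a) y = y) → y ∈ divisorClassesSpan A.X A.dim a :=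
  exists_polarization_invariants_le_of_isIsogenous hBA.symm' hB

/-- **A polarization package gives the record** (Cor. 4.5 with Thm. 4.4): if `0 < dim A` and `A` carries
`D ∈ B¹(A) ⊗ ℂ` with `D^{dim A} ≠ 0`, `Q_D` non-degenerate and the `S(A)(ℂ)`-form, then every class of
`H^{2p}(A(ℂ); ℂ)` fixed by `specialLefschetzGroup (dim A) A.X` lies in `Dᵖ_hom(A)_ℂ` (the Künneth families
`⋀•u`, `u ∈ S(A)(ℂ)`, lie in the special Lefschetz group, `exteriorPullbackEquiv_mem_specialLefschetzGroup`).
[cite: Milne1999LefschetzClasses, Thm. 4.4 and Cor. 4.5 (p. 659)] -/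
theorem specialLefschetzGroup_invariants_le_of_exists_polarization_invariants_le (hA0 : 0 < A.dim)
    (hA : ∃ D : complexBetti A.X 2, D ∈ hodgeClassSpan A.dim A.X 1 ∧ lefschetzPow D (A.dim - 1) 2 D ≠ 0 ∧
      (∀ z : complexBetti A.X 1, (∀ y, polarizationPairingOne A.X D (A.dim - 1) z y = 0) → z = 0) ∧
      ∀ (a : ℕ) (y : complexBetti A.X (2 * a)), (∀ u ∈ unitaryCentralizerGroup A D,
        exteriorPullback (AbelianVariety.hasExteriorCohomologyH1_complexPoints A)
          (u : complexBetti A.X 1 →ₗ[ℂ] complexBetti A.X 1) (2 * a) y = y) → y ∈ divisorClassesSpan A.X A.dim a)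
    (p : ℕ) (x : complexBetti A.X (2 * p)) (hx : ∀ g ∈ specialLefschetzGroup A.dim A.X, g (2 * p) x = x) :
    x ∈ divisorClassesSpan A.X A.dim p := by
  obtain ⟨D, hh, htop, hnd, rec⟩ := hA
  exact rec p x fun u hu ↦ hx _ (exteriorPullbackEquiv_mem_specialLefschetzGroup hA0 hh htop hnd hu)

/-- **The record along an isogeny onto a packaged target, `IsIsogenous` form** of the tree's
`specialLefschetzGroup_invariants_le_of_isIsogeny_of_forall`. [cite: Milne1999LefschetzClasses, §1 p. 644, Cor. 4.5] -/
theorem specialLefschetzGroup_invariants_le_of_isIsogenous_of_exists (hAB : AbelianVariety.IsIsogenous A B)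
    (hB0 : 0 < B.dim)
    (hB : ∃ D : complexBetti B.X 2, D ∈ hodgeClassSpan B.dim B.X 1 ∧ lefschetzPow D (B.dim - 1) 2 D ≠ 0 ∧
      (∀ z : complexBetti B.X 1, (∀ y, polarizationPairingOne B.X D (B.dim - 1) z y = 0) → z = 0) ∧
      ∀ (a : ℕ) (y : complexBetti B.X (2 * a)), (∀ u ∈ unitaryCentralizerGroup B D,
        exteriorPullback (AbelianVariety.hasExteriorCohomologyH1_complexPoints B)
          (u : complexBetti B.X 1 →ₗ[ℂ] complexBetti B.X 1) (2 * a) y = y) → y ∈ divisorClassesSpan B.X B.dim a)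
    (p : ℕ) (x : complexBetti A.X (2 * p)) (hx : ∀ g ∈ specialLefschetzGroup A.dim A.X, g (2 * p) x = x) :
    x ∈ divisorClassesSpan A.X A.dim p := by
  obtain ⟨f, hf⟩ := hAB
  exact specialLefschetzGroup_invariants_le_of_exists_polarization_invariants_le
    ((AbelianVariety.dim_eq_of_isIsogeny hf).symm ▸ hB0) (exists_polarization_invariants_le_of_isIsogeny hf hB)
    p x hx

end Transport

/-! ### §2 The finite product `⨁_{i : Fin (n+1)} Aᵢ` of pairwise `Hom`-orthogonal factors -/

section Orthogonal

variable {n : ℕ} {A : Fin (n + 1) → AbelianVariety ℂ}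

/-- `Hom(A₀, ⨁_{i<n} A_{i+1}) = 0` when `Hom(Aᵢ, Aⱼ) = 0` for `i ≠ j` (a morphism into a biproduct vanishes
with its components). [cite: MumfordAV1970, §19 (p. 174)] -/
theorem hom_to_biproduct_succ_eq_zero (hOrth : ∀ i j, i ≠ j → ∀ f : A i ⟶ A j, f = 0)
    (f : A 0 ⟶ ⨁ fun i : Fin n => A i.succ) : f = 0 :=
  biproduct.hom_ext _ _ fun i => by
    rw [zero_comp]
    exact hOrth 0 i.succ (Fin.succ_ne_zero i).symm _

/-- `Hom(⨁_{i<n} A_{i+1}, A₀) = 0` when `Hom(Aᵢ, Aⱼ) = 0` for `i ≠ j` (a morphism out of a biproduct vanishes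
with its components). [cite: MumfordAV1970, §19 (p. 174)] -/
theorem hom_from_biproduct_succ_eq_zero (hOrth : ∀ i j, i ≠ j → ∀ f : A i ⟶ A j, f = 0)
    (g : (⨁ fun i : Fin n => A i.succ) ⟶ A 0) : g = 0 :=
  biproduct.hom_ext' _ _ fun i => by
    rw [comp_zero]
    exact hOrth i.succ 0 (Fin.succ_ne_zero i) _

/-- The tail `(A_{i+1})ᵢ` of a pairwise `Hom`-orthogonal family is pairwise `Hom`-orthogonal (index
bookkeeping for the induction; private). [folklore] -/
private theorem forall_hom_succ_eq_zero (hOrth : ∀ i j, i ≠ j → ∀ f : A i ⟶ A j, f = 0) :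
    ∀ i j : Fin n, i ≠ j → ∀ f : A i.succ ⟶ A j.succ, f = 0 :=
  fun i j hij ↦ hOrth i.succ j.succ fun e ↦ hij (Fin.succ_inj.1 e)

end Orthogonal

section FiniteProduct

/-- **Milne Prop. 3.4, start of proof — "by 3.1 and induction" — on a finite product, the `S(ℂ)`-form**: let
`A₀, …, A_n` be positive-dimensional complex abelian varieties with `Hom(Aᵢ, Aⱼ) = 0` for `i ≠ j`, carrying
classes `hᵢ ∈ B¹(Aᵢ) ⊗ ℂ` with `hᵢ^{dim Aᵢ} ≠ 0` and `Q_{hᵢ}` non-degenerate on `H¹(Aᵢ)`, such that on each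
factor every class of `H^{2a}(Aᵢ(ℂ); ℂ)` fixed by `⋀^{2a} S(Aᵢ)(ℂ)` lies in `Dᵃ(Aᵢ) ⊗ ℂ`. Then every class of
`H^{2p}((⨁ Aᵢ)(ℂ); ℂ)` fixed by `⋀^{2p}u` for all `u ∈ S(⨁ Aᵢ)(ℂ)` — for Milne's product divisor class
`D = Σ πᵢ^* hᵢ` (`sumPolarizationClass`) — lies in `Dᵖ(⨁ Aᵢ) ⊗ ℂ`. Induction along the isogeny
`⨁_{Fin (n+1)} A → A 0 × ⨁_{Fin n} (A ∘ succ)` (`biproductSuccSplit`, pulling the binary product class back to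
`D`, `map_biproductSuccSplit_prodPolarizationClass`): the binary step is the tree's
`mem_divisorClassesSpan_prod_of_forall_exteriorPullback_eq` (Lemma 3.1 for `S(A 0) × 1` and `1 × S(rest)`,
Prop. 1.5), the transport is §1. [cite: Milne1999LefschetzClasses, Prop. 3.4 (start of proof, p. 654), Lemma 3.1, Prop. 1.5, §1 p. 643]
[cite: MumfordAV1970, §19] -/
theorem mem_divisorClassesSpan_biproduct_of_forall_exteriorPullback_eq_of_forall :
    ∀ {n : ℕ} (A : Fin (n + 1) → AbelianVariety ℂ) (h : ∀ i, complexBetti (A i).X 2),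
    (∀ i j, i ≠ j → ∀ f : A i ⟶ A j, f = 0) → (∀ i, 0 < (A i).dim) →
    (∀ i, h i ∈ hodgeClassSpan (A i).dim (A i).X 1) →
    (∀ i, lefschetzPow (h i) ((A i).dim - 1) 2 (h i) ≠ 0) →
    (∀ (i) (z : complexBetti (A i).X 1),
      (∀ y, polarizationPairingOne (A i).X (h i) ((A i).dim - 1) z y = 0) → z = 0) →
    (∀ (i) (a : ℕ) (y : complexBetti (A i).X (2 * a)), (∀ s ∈ unitaryCentralizerGroup (A i) (h i),
      exteriorPullback (AbelianVariety.hasExteriorCohomologyH1_complexPoints (A i))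
        (s : complexBetti (A i).X 1 →ₗ[ℂ] complexBetti (A i).X 1) (2 * a) y = y) →
      y ∈ divisorClassesSpan (A i).X (A i).dim a) →
    ∀ (p : ℕ) (x : complexBetti (⨁ A).X (2 * p)),
      (∀ u ∈ unitaryCentralizerGroup (⨁ A) (sumPolarizationClass A h),
        exteriorPullback (AbelianVariety.hasExteriorCohomologyH1_complexPoints (⨁ A))
          (u : complexBetti (⨁ A).X 1 →ₗ[ℂ] complexBetti (⨁ A).X 1) (2 * p) x = x) →
      x ∈ divisorClassesSpan (⨁ A).X (⨁ A).dim p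
  | 0, A, h, _, _, _, _, _, rec, p, x, hx => by
    rw [sumPolarizationClass_fin_one] at hx
    exact mem_divisorClassesSpan_of_isIsogeny_of_forall_exteriorPullback_eq (isIsogeny_biproduct_π_fin_one A)
      (rec 0) p x hx
  | n + 1, A, h, hOrth, h0, hh, htop, hnd, rec, p, x, hx => by
    have IH := mem_divisorClassesSpan_biproduct_of_forall_exteriorPullback_eq_of_forall
      (fun i : Fin (n + 1) => A i.succ) (fun i => h i.succ) (forall_hom_succ_eq_zero hOrth) (fun i => h0 _)
      (fun i => hh _) (fun i => htop _) (fun i => hnd _) (fun i => rec _)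
    obtain ⟨-, htop', -⟩ := sumPolarizationClass_hypotheses (fun i : Fin (n + 1) => A i.succ)
      (fun i => h i.succ) (fun i => h0 _) (fun i => hh _) (fun i => htop _) (fun i => hnd _)
    have H := mem_divisorClassesSpan_prod_of_forall_exteriorPullback_eq (hom_to_biproduct_succ_eq_zero hOrth)
      (hom_from_biproduct_succ_eq_zero hOrth) (htop 0) htop' (rec 0) IH
    rw [← map_biproductSuccSplit_prodPolarizationClass] at hx
    exact mem_divisorClassesSpan_of_isIsogeny_of_forall_exteriorPullback_eq (isIsogeny_biproductSuccSplit A) H p x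
      hx

variable {n : ℕ} {A : Fin (n + 1) → AbelianVariety ℂ}

/-- **The polarization package of a finite product from packages of the factors**: for pairwise
`Hom`-orthogonal positive-dimensional `A₀, …, A_n` each carrying a class `Dᵢ ∈ B¹(Aᵢ) ⊗ ℂ` with
`Dᵢ^{dim Aᵢ} ≠ 0`, `Q_{Dᵢ}` non-degenerate and the `S(Aᵢ)(ℂ)`-form of Cor. 4.5, Milne's product divisor class
`Σ πᵢ^* Dᵢ` is such a class on `⨁ Aᵢ` (its three polarization hypotheses: the tree's
`sumPolarizationClass_hypotheses`, "`D = Σᵢ A₁ × ⋯ × Dᵢ × ⋯ × A_s` is an ample divisor on `A`", §1 p. 643).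
[cite: Milne1999LefschetzClasses, §1 p. 643 and Prop. 3.4 (start of proof, p. 654)] -/
theorem exists_polarization_invariants_le_biproduct_of_forall_exists
    (hOrth : ∀ i j, i ≠ j → ∀ f : A i ⟶ A j, f = 0) (h0 : ∀ i, 0 < (A i).dim)
    (hA : ∀ i, ∃ D : complexBetti (A i).X 2, D ∈ hodgeClassSpan (A i).dim (A i).X 1 ∧
      lefschetzPow D ((A i).dim - 1) 2 D ≠ 0 ∧
      (∀ z : complexBetti (A i).X 1, (∀ y, polarizationPairingOne (A i).X D ((A i).dim - 1) z y = 0) → z = 0) ∧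
      ∀ (a : ℕ) (y : complexBetti (A i).X (2 * a)), (∀ u ∈ unitaryCentralizerGroup (A i) D,
        exteriorPullback (AbelianVariety.hasExteriorCohomologyH1_complexPoints (A i))
          (u : complexBetti (A i).X 1 →ₗ[ℂ] complexBetti (A i).X 1) (2 * a) y = y) →
        y ∈ divisorClassesSpan (A i).X (A i).dim a) :
    ∃ D : complexBetti (⨁ A).X 2, D ∈ hodgeClassSpan (⨁ A).dim (⨁ A).X 1 ∧
      lefschetzPow D ((⨁ A).dim - 1) 2 D ≠ 0 ∧
      (∀ z : complexBetti (⨁ A).X 1, (∀ y, polarizationPairingOne (⨁ A).X D ((⨁ A).dim - 1) z y = 0) → z = 0) ∧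
      ∀ (a : ℕ) (y : complexBetti (⨁ A).X (2 * a)), (∀ u ∈ unitaryCentralizerGroup (⨁ A) D,
        exteriorPullback (AbelianVariety.hasExteriorCohomologyH1_complexPoints (⨁ A))
          (u : complexBetti (⨁ A).X 1 →ₗ[ℂ] complexBetti (⨁ A).X 1) (2 * a) y = y) →
        y ∈ divisorClassesSpan (⨁ A).X (⨁ A).dim a := by
  choose D hh htop hnd rec using hA
  obtain ⟨HH, HT, HN⟩ := sumPolarizationClass_hypotheses A D h0 hh htop hnd
  exact ⟨_, HH, HT, HN,
    mem_divisorClassesSpan_biproduct_of_forall_exteriorPullback_eq_of_forall A D hOrth h0 hh htop hnd rec⟩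

/-- **Milne 1999, Cor. 4.5 (with Thm. 4.4 and Thm. 3.2) — the conclusion of the record
`Milne1999_specialLefschetzGroup_invariants_le` — for a finite product `⨁ Aᵢ` of pairwise `Hom`-orthogonal
positive-dimensional factors carrying polarization packages** (Prop. 3.4, start of proof: "If the proposition
is true for each variety `Aᵢ^{rᵢ}` […] then it is clear that it is also true for `A`"): every class of
`H^{2p}((⨁ Aᵢ)(ℂ); ℂ)` fixed by `specialLefschetzGroup (dim ⨁ Aᵢ) (⨁ Aᵢ).X` lies in `Dᵖ_hom(⨁ Aᵢ)_ℂ`.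
[cite: Milne1999LefschetzClasses, Prop. 3.4 (start of proof, p. 654), Thm. 4.4, Cor. 4.5 (p. 659)] -/
theorem specialLefschetzGroup_invariants_le_biproduct_of_forall_exists
    (hOrth : ∀ i j, i ≠ j → ∀ f : A i ⟶ A j, f = 0) (h0 : ∀ i, 0 < (A i).dim)
    (hA : ∀ i, ∃ D : complexBetti (A i).X 2, D ∈ hodgeClassSpan (A i).dim (A i).X 1 ∧
      lefschetzPow D ((A i).dim - 1) 2 D ≠ 0 ∧
      (∀ z : complexBetti (A i).X 1, (∀ y, polarizationPairingOne (A i).X D ((A i).dim - 1) z y = 0) → z = 0) ∧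
      ∀ (a : ℕ) (y : complexBetti (A i).X (2 * a)), (∀ u ∈ unitaryCentralizerGroup (A i) D,
        exteriorPullback (AbelianVariety.hasExteriorCohomologyH1_complexPoints (A i))
          (u : complexBetti (A i).X 1 →ₗ[ℂ] complexBetti (A i).X 1) (2 * a) y = y) →
        y ∈ divisorClassesSpan (A i).X (A i).dim a)
    (p : ℕ) (x : complexBetti (⨁ A).X (2 * p))
    (hx : ∀ g ∈ specialLefschetzGroup (⨁ A).dim (⨁ A).X, g (2 * p) x = x) :
    x ∈ divisorClassesSpan (⨁ A).X (⨁ A).dim p :=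
  specialLefschetzGroup_invariants_le_of_exists_polarization_invariants_le (dim_biproduct_pos A (h0 0))
    (exists_polarization_invariants_le_biproduct_of_forall_exists hOrth h0 hA) p x hx

/-- **… and for EVERY complex abelian variety isogenous onto such a product** (Prop. 3.4, start of proof:
"an isogeny `A → A₁^{r₁} × ⋯ × A_s^{r_s}` […] defines isomorphisms …"; `S` and `D_hom` are isogeny
invariants). [cite: Milne1999LefschetzClasses, Prop. 3.4 (start of proof, p. 654), §1 p. 644, Cor. 4.5 (p. 659)] -/
theorem specialLefschetzGroup_invariants_le_of_isIsogenous_biproduct_of_forall_exists {X : AbelianVariety ℂ}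
    (hX : AbelianVariety.IsIsogenous X (⨁ A))
    (hOrth : ∀ i j, i ≠ j → ∀ f : A i ⟶ A j, f = 0) (h0 : ∀ i, 0 < (A i).dim)
    (hA : ∀ i, ∃ D : complexBetti (A i).X 2, D ∈ hodgeClassSpan (A i).dim (A i).X 1 ∧
      lefschetzPow D ((A i).dim - 1) 2 D ≠ 0 ∧
      (∀ z : complexBetti (A i).X 1, (∀ y, polarizationPairingOne (A i).X D ((A i).dim - 1) z y = 0) → z = 0) ∧
      ∀ (a : ℕ) (y : complexBetti (A i).X (2 * a)), (∀ u ∈ unitaryCentralizerGroup (A i) D,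
        exteriorPullback (AbelianVariety.hasExteriorCohomologyH1_complexPoints (A i))
          (u : complexBetti (A i).X 1 →ₗ[ℂ] complexBetti (A i).X 1) (2 * a) y = y) →
        y ∈ divisorClassesSpan (A i).X (A i).dim a)
    (p : ℕ) (x : complexBetti X.X (2 * p)) (hx : ∀ g ∈ specialLefschetzGroup X.dim X.X, g (2 * p) x = x) :
    x ∈ divisorClassesSpan X.X X.dim p :=
  specialLefschetzGroup_invariants_le_of_isIsogenous_of_exists hX (dim_biproduct_pos A (h0 0))
    (exists_polarization_invariants_le_biproduct_of_forall_exists hOrth h0 hA) p x hx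

/-- **… and for every complex abelian variety onto which such a product is isogenous** (Prop. 1.1: "there
exists an isogeny `A₁^{r₁} × ⋯ × A_s^{r_s} → A`"). [cite: Milne1999LefschetzClasses, Prop. 1.1 (p. 643), Prop. 3.4 (p. 654), Cor. 4.5] -/
theorem specialLefschetzGroup_invariants_le_of_isIsogenous_biproduct_of_forall_exists' {X : AbelianVariety ℂ}
    (hX : AbelianVariety.IsIsogenous (⨁ A) X)
    (hOrth : ∀ i j, i ≠ j → ∀ f : A i ⟶ A j, f = 0) (h0 : ∀ i, 0 < (A i).dim)
    (hA : ∀ i, ∃ D : complexBetti (A i).X 2, D ∈ hodgeClassSpan (A i).dim (A i).X 1 ∧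
      lefschetzPow D ((A i).dim - 1) 2 D ≠ 0 ∧
      (∀ z : complexBetti (A i).X 1, (∀ y, polarizationPairingOne (A i).X D ((A i).dim - 1) z y = 0) → z = 0) ∧
      ∀ (a : ℕ) (y : complexBetti (A i).X (2 * a)), (∀ u ∈ unitaryCentralizerGroup (A i) D,
        exteriorPullback (AbelianVariety.hasExteriorCohomologyH1_complexPoints (A i))
          (u : complexBetti (A i).X 1 →ₗ[ℂ] complexBetti (A i).X 1) (2 * a) y = y) →
        y ∈ divisorClassesSpan (A i).X (A i).dim a)
    (p : ℕ) (x : complexBetti X.X (2 * p)) (hx : ∀ g ∈ specialLefschetzGroup X.dim X.X, g (2 * p) x = x) :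
    x ∈ divisorClassesSpan X.X X.dim p :=
  specialLefschetzGroup_invariants_le_of_isIsogenous_biproduct_of_forall_exists hX.symm' hOrth h0 hA p x hx

/-- **Cor. 4.5 as an equality of sets** on everything isogenous to such a product: the `S(X)`-invariants of
`H^{2p}(X(ℂ); ℂ)` are EXACTLY `Dᵖ_hom(X)_ℂ`. [cite: Milne1999LefschetzClasses, Cor. 4.5 (p. 659) and Prop. 3.4] -/
theorem setOf_forall_apply_eq_self_eq_divisorClassesSpan_of_isIsogenous_biproduct {X : AbelianVariety ℂ}
    (hX : AbelianVariety.IsIsogenous X (⨁ A))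
    (hOrth : ∀ i j, i ≠ j → ∀ f : A i ⟶ A j, f = 0) (h0 : ∀ i, 0 < (A i).dim)
    (hA : ∀ i, ∃ D : complexBetti (A i).X 2, D ∈ hodgeClassSpan (A i).dim (A i).X 1 ∧
      lefschetzPow D ((A i).dim - 1) 2 D ≠ 0 ∧
      (∀ z : complexBetti (A i).X 1, (∀ y, polarizationPairingOne (A i).X D ((A i).dim - 1) z y = 0) → z = 0) ∧
      ∀ (a : ℕ) (y : complexBetti (A i).X (2 * a)), (∀ u ∈ unitaryCentralizerGroup (A i) D,
        exteriorPullback (AbelianVariety.hasExteriorCohomologyH1_complexPoints (A i))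
          (u : complexBetti (A i).X 1 →ₗ[ℂ] complexBetti (A i).X 1) (2 * a) y = y) →
        y ∈ divisorClassesSpan (A i).X (A i).dim a)
    (p : ℕ) :
    {x : complexBetti X.X (2 * p) | ∀ g ∈ specialLefschetzGroup X.dim X.X, g (2 * p) x = x} =
      (divisorClassesSpan X.X X.dim p : Set _) :=
  Set.Subset.antisymm
    (fun x hx ↦ specialLefschetzGroup_invariants_le_of_isIsogenous_biproduct_of_forall_exists hX hOrth h0 hA p x hx)
    fun _ hx _ hg ↦ apply_eq_self_of_mem_specialLefschetzGroup hg hx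

/-- **Milne Prop. 4.8, (c) ⇒ (a), record-free** on everything isogenous to such a product: if
`Hg′(X) = S(X)` then `B(X) = D(X)`. [cite: Milne1999LefschetzClasses, Prop. 4.8 and Cor. 4.5 (pp. 659–660)] -/
theorem isDivisorGenerated_of_hodgeGroup_eq_specialLefschetzGroup_of_isIsogenous_biproduct {X : AbelianVariety ℂ}
    (hX : AbelianVariety.IsIsogenous X (⨁ A))
    (hOrth : ∀ i j, i ≠ j → ∀ f : A i ⟶ A j, f = 0) (h0 : ∀ i, 0 < (A i).dim)
    (hA : ∀ i, ∃ D : complexBetti (A i).X 2, D ∈ hodgeClassSpan (A i).dim (A i).X 1 ∧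
      lefschetzPow D ((A i).dim - 1) 2 D ≠ 0 ∧
      (∀ z : complexBetti (A i).X 1, (∀ y, polarizationPairingOne (A i).X D ((A i).dim - 1) z y = 0) → z = 0) ∧
      ∀ (a : ℕ) (y : complexBetti (A i).X (2 * a)), (∀ u ∈ unitaryCentralizerGroup (A i) D,
        exteriorPullback (AbelianVariety.hasExteriorCohomologyH1_complexPoints (A i))
          (u : complexBetti (A i).X 1 →ₗ[ℂ] complexBetti (A i).X 1) (2 * a) y = y) →
        y ∈ divisorClassesSpan (A i).X (A i).dim a)
    (hHg : hodgeGroup X.dim X.X = specialLefschetzGroup X.dim X.X) :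
    IsDivisorGenerated X :=
  fun p c hc hpp ↦ specialLefschetzGroup_invariants_le_of_isIsogenous_biproduct_of_forall_exists hX hOrth h0 hA p c
    fun _ hg ↦ apply_eq_self_of_mem_hodgeGroup (hHg ▸ hg) hc hpp

end FiniteProduct

/-! ### §3 Polarization packages of the known factors -/

section Packages

variable {B C : AbelianVariety ℂ}

/-- **Package of an abelian variety with commutative `End`** (a simple abelian variety of type I, or of type
IV with `d = 1`, …): the rational Kähler class `h` of a projective embedding (`exists_polarizationClass`) with
the tree's torus argument `mem_divisorClassesSpan_of_forall_exteriorPullback_eq_of_forall_comp_comm`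
(Milne Thm. 3.2 / p. 657 for `End(B)` commutative). [cite: Milne1999LefschetzClasses, Thm. 3.2, Lemma 3.8 and p. 657, Cor. 4.5] -/
theorem exists_polarization_invariants_le_of_forall_comp_comm (hB0 : 0 < B.dim)
    (hcomm : ∀ φ ψ : B ⟶ B, φ ≫ ψ = ψ ≫ φ) :
    ∃ D : complexBetti B.X 2, D ∈ hodgeClassSpan B.dim B.X 1 ∧ lefschetzPow D (B.dim - 1) 2 D ≠ 0 ∧
      (∀ z : complexBetti B.X 1, (∀ y, polarizationPairingOne B.X D (B.dim - 1) z y = 0) → z = 0) ∧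
      ∀ (a : ℕ) (y : complexBetti B.X (2 * a)), (∀ u ∈ unitaryCentralizerGroup B D,
        exteriorPullback (AbelianVariety.hasExteriorCohomologyH1_complexPoints B)
          (u : complexBetti B.X 1 →ₗ[ℂ] complexBetti B.X 1) (2 * a) y = y) → y ∈ divisorClassesSpan B.X B.dim a := by
  obtain ⟨h, hQ, hK, hh, htop, hnd⟩ := exists_polarizationClass B hB0
  exact ⟨h, hh, htop, hnd, fun a y hy ↦
    mem_divisorClassesSpan_of_forall_exteriorPullback_eq_of_forall_comp_comm hcomm hQ hK a y hy⟩

/-- **Package of an abelian variety with `B = D`** (`IsDivisorGenerated`: dimension `≤ 3`, products of elliptic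
curves, anything isogenous to such, …): any polarization class, with the Hodge-group road
`mem_divisorClassesSpan_of_forall_exteriorPullback_eq_of_isDivisorGenerated` (`S ⊇ Hg`, Deligne I 3.4).
[cite: Milne1999LefschetzClasses, Cor. 4.5 and Prop. 4.8] [cite: Deligne1982HodgeCycles, I Prop. 3.4] -/
theorem exists_polarization_invariants_le_of_isDivisorGenerated (hB0 : 0 < B.dim) (hD : IsDivisorGenerated B) :
    ∃ D : complexBetti B.X 2, D ∈ hodgeClassSpan B.dim B.X 1 ∧ lefschetzPow D (B.dim - 1) 2 D ≠ 0 ∧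
      (∀ z : complexBetti B.X 1, (∀ y, polarizationPairingOne B.X D (B.dim - 1) z y = 0) → z = 0) ∧
      ∀ (a : ℕ) (y : complexBetti B.X (2 * a)), (∀ u ∈ unitaryCentralizerGroup B D,
        exteriorPullback (AbelianVariety.hasExteriorCohomologyH1_complexPoints B)
          (u : complexBetti B.X 1 →ₗ[ℂ] complexBetti B.X 1) (2 * a) y = y) → y ∈ divisorClassesSpan B.X B.dim a := by
  obtain ⟨h, -, -, hh, htop, hnd⟩ := exists_polarizationClass B hB0
  exact ⟨h, hh, htop, hnd, fun a y hy ↦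
    mem_divisorClassesSpan_of_forall_exteriorPullback_eq_of_isDivisorGenerated hD hh a y hy⟩

/-- **Package of a factor with commutative `End` OR `B = D`** (the disjunction used by the closed-hypothesis
corollaries of §4). [cite: Milne1999LefschetzClasses, Thm. 3.2, Cor. 4.5, Prop. 4.8] -/
theorem exists_polarization_invariants_le_of_forall_comp_comm_or_isDivisorGenerated (hB0 : 0 < B.dim)
    (hB : (∀ φ ψ : B ⟶ B, φ ≫ ψ = ψ ≫ φ) ∨ IsDivisorGenerated B) :
    ∃ D : complexBetti B.X 2, D ∈ hodgeClassSpan B.dim B.X 1 ∧ lefschetzPow D (B.dim - 1) 2 D ≠ 0 ∧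
      (∀ z : complexBetti B.X 1, (∀ y, polarizationPairingOne B.X D (B.dim - 1) z y = 0) → z = 0) ∧
      ∀ (a : ℕ) (y : complexBetti B.X (2 * a)), (∀ u ∈ unitaryCentralizerGroup B D,
        exteriorPullback (AbelianVariety.hasExteriorCohomologyH1_complexPoints B)
          (u : complexBetti B.X 1 →ₗ[ℂ] complexBetti B.X 1) (2 * a) y = y) → y ∈ divisorClassesSpan B.X B.dim a :=
  hB.elim (exists_polarization_invariants_le_of_forall_comp_comm hB0)
    (exists_polarization_invariants_le_of_isDivisorGenerated hB0)

/-- **Package of a power `X^{N+1}` of a simple complex abelian variety of CM type** (Milne's isotypic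
component `Aᵢ^{rᵢ}` with `Aᵢ` of CM type): `X` is isogenous to a CM-typed model `X′` with commutative `End`
(`exists_isCMTyped_isIsogenous_of_isSimple`, Milne 1999b §2 p. 54), `X^{N+1} ∼ X′^{N+1} ≅ ⨁_{Fin (N+1)} X′`,
the torus argument with multiplicity (the tree's `exists_polarization_invariants_le_biproduct_of_classes`,
Lemma 3.8 "each has the same multiplicity") packages the biproduct, and §1 pulls the package back.
[cite: Milne1999LefschetzClasses, Thm. 3.2, Lemma 3.8 and p. 657, §1 pp. 643–644] [cite: Milne1999, §2 p. 54] -/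
theorem exists_polarization_invariants_le_powSucc_of_isSimple_of_isOfCMType {X : AbelianVariety ℂ}
    (hXs : AbelianVariety.IsSimple X) (hX0 : 0 < X.dim) (hCM : IsOfCMType X) (N : ℕ) :
    ∃ D : complexBetti (X.powSucc N).X 2, D ∈ hodgeClassSpan (X.powSucc N).dim (X.powSucc N).X 1 ∧
      lefschetzPow D ((X.powSucc N).dim - 1) 2 D ≠ 0 ∧
      (∀ z : complexBetti (X.powSucc N).X 1,
        (∀ y, polarizationPairingOne (X.powSucc N).X D ((X.powSucc N).dim - 1) z y = 0) → z = 0) ∧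
      ∀ (a : ℕ) (y : complexBetti (X.powSucc N).X (2 * a)), (∀ u ∈ unitaryCentralizerGroup (X.powSucc N) D,
        exteriorPullback (AbelianVariety.hasExteriorCohomologyH1_complexPoints (X.powSucc N))
          (u : complexBetti (X.powSucc N).X 1 →ₗ[ℂ] complexBetti (X.powSucc N).X 1) (2 * a) y = y) →
        y ∈ divisorClassesSpan (X.powSucc N).X (X.powSucc N).dim a := by
  obtain ⟨X', hX'T, hiso⟩ := exists_isCMTyped_isIsogenous_of_isSimple X hXs hX0 hCM
  obtain @⟨K, _, _, _, Φ, _, ι, θ, hX'⟩ := hX'T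
  obtain ⟨g, hg⟩ := hiso
  have hX's : AbelianVariety.IsSimple X' := hXs.of_isIsogeny hg
  have hX'CM : IsOfCMType X' := hCM.of_isIsogeny hg
  have hEnd : ∀ φ ψ : X' ⟶ X', φ ≫ ψ = ψ ≫ φ := comp_comm_of_isSimple_of_isOfCMType hX's hX'CM
  obtain ⟨D, HH, HT, HN, H⟩ := exists_polarization_invariants_le_biproduct_of_classes (C := Unit)
    (K' := fun _ => K) (Φ' := fun _ => Φ) (A' := fun _ => X') (ι' := fun _ => ι) (θ' := fun _ => θ)
    (fun _ => hX') (fun _ _ h => absurd rfl h) (fun _ => hEnd) (fun _ : Fin (N + 1) => ())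
  exact exists_polarization_invariants_le_of_isIsogenous
    ((isIsogenous_powSucc ⟨g, hg⟩ N).trans (isIsogenous_powSucc_biproduct X' N)) ⟨D, HH, HT, HN, H⟩

/-- **Package of a simple complex abelian variety of CM type** (`N = 0`: `X.powSucc 0 = X`).
[cite: Milne1999LefschetzClasses, Thm. 3.2 and p. 657] [cite: Milne1999, §2 p. 54] -/
theorem exists_polarization_invariants_le_of_isSimple_of_isOfCMType {X : AbelianVariety ℂ}
    (hXs : AbelianVariety.IsSimple X) (hX0 : 0 < X.dim) (hCM : IsOfCMType X) :
    ∃ D : complexBetti X.X 2, D ∈ hodgeClassSpan X.dim X.X 1 ∧ lefschetzPow D (X.dim - 1) 2 D ≠ 0 ∧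
      (∀ z : complexBetti X.X 1, (∀ y, polarizationPairingOne X.X D (X.dim - 1) z y = 0) → z = 0) ∧
      ∀ (a : ℕ) (y : complexBetti X.X (2 * a)), (∀ u ∈ unitaryCentralizerGroup X D,
        exteriorPullback (AbelianVariety.hasExteriorCohomologyH1_complexPoints X)
          (u : complexBetti X.X 1 →ₗ[ℂ] complexBetti X.X 1) (2 * a) y = y) → y ∈ divisorClassesSpan X.X X.dim a :=
  exists_polarization_invariants_le_powSucc_of_isSimple_of_isOfCMType hXs hX0 hCM 0

/-- **The binary product of two packages** (`Hom(B, C) = 0 = Hom(C, B)`, positive-dimensional factors): the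
product class `pr_B^* D_B + pr_C^* D_C` packages `B × C` (the tree's
`mem_divisorClassesSpan_prod_of_forall_exteriorPullback_eq` with `prodPolarizationClass_mem_hodgeClassSpan`,
`lefschetzPow_prodPolarizationClass_self_ne_zero`, `eq_zero_of_forall_polarizationPairingOne_prod_eq_zero`).
[cite: Milne1999LefschetzClasses, §1 p. 643, Lemma 3.1, Prop. 3.4 (p. 654)] -/
theorem exists_polarization_invariants_le_prod (hBC : ∀ f : B ⟶ C, f = 0) (hCB : ∀ g : C ⟶ B, g = 0)
    (hB0 : 0 < B.dim) (hC0 : 0 < C.dim)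
    (hB : ∃ D : complexBetti B.X 2, D ∈ hodgeClassSpan B.dim B.X 1 ∧ lefschetzPow D (B.dim - 1) 2 D ≠ 0 ∧
      (∀ z : complexBetti B.X 1, (∀ y, polarizationPairingOne B.X D (B.dim - 1) z y = 0) → z = 0) ∧
      ∀ (a : ℕ) (y : complexBetti B.X (2 * a)), (∀ u ∈ unitaryCentralizerGroup B D,
        exteriorPullback (AbelianVariety.hasExteriorCohomologyH1_complexPoints B)
          (u : complexBetti B.X 1 →ₗ[ℂ] complexBetti B.X 1) (2 * a) y = y) → y ∈ divisorClassesSpan B.X B.dim a)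
    (hC : ∃ D : complexBetti C.X 2, D ∈ hodgeClassSpan C.dim C.X 1 ∧ lefschetzPow D (C.dim - 1) 2 D ≠ 0 ∧
      (∀ z : complexBetti C.X 1, (∀ y, polarizationPairingOne C.X D (C.dim - 1) z y = 0) → z = 0) ∧
      ∀ (a : ℕ) (y : complexBetti C.X (2 * a)), (∀ u ∈ unitaryCentralizerGroup C D,
        exteriorPullback (AbelianVariety.hasExteriorCohomologyH1_complexPoints C)
          (u : complexBetti C.X 1 →ₗ[ℂ] complexBetti C.X 1) (2 * a) y = y) → y ∈ divisorClassesSpan C.X C.dim a) :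
    ∃ D : complexBetti (B.prod C).X 2, D ∈ hodgeClassSpan (B.prod C).dim (B.prod C).X 1 ∧
      lefschetzPow D ((B.prod C).dim - 1) 2 D ≠ 0 ∧
      (∀ z : complexBetti (B.prod C).X 1,
        (∀ y, polarizationPairingOne (B.prod C).X D ((B.prod C).dim - 1) z y = 0) → z = 0) ∧
      ∀ (a : ℕ) (y : complexBetti (B.prod C).X (2 * a)), (∀ u ∈ unitaryCentralizerGroup (B.prod C) D,
        exteriorPullback (AbelianVariety.hasExteriorCohomologyH1_complexPoints (B.prod C))
          (u : complexBetti (B.prod C).X 1 →ₗ[ℂ] complexBetti (B.prod C).X 1) (2 * a) y = y) →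
        y ∈ divisorClassesSpan (B.prod C).X (B.prod C).dim a := by
  obtain ⟨hB, hhB, hBtop, hndB, recB⟩ := hB
  obtain ⟨hC, hhC, hCtop, hndC, recC⟩ := hC
  exact ⟨_, prodPolarizationClass_mem_hodgeClassSpan hB hC hhB hhC,
    lefschetzPow_prodPolarizationClass_self_ne_zero hB hC hB0 hC0 hBtop hCtop,
    eq_zero_of_forall_polarizationPairingOne_prod_eq_zero hB hC hB0 hC0 hBtop hCtop hndB hndC,
    mem_divisorClassesSpan_prod_of_forall_exteriorPullback_eq hBC hCB hBtop hCtop recB recC⟩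

/-- **The record for everything isogenous onto a binary product `B × C` of packaged `Hom`-orthogonal
factors.** [cite: Milne1999LefschetzClasses, Prop. 3.4 (p. 654), §1 p. 644, Cor. 4.5] -/
theorem specialLefschetzGroup_invariants_le_of_isIsogenous_prod_of_exists {X : AbelianVariety ℂ}
    (hX : AbelianVariety.IsIsogenous X (B.prod C)) (hBC : ∀ f : B ⟶ C, f = 0) (hCB : ∀ g : C ⟶ B, g = 0)
    (hB0 : 0 < B.dim) (hC0 : 0 < C.dim)
    (hB : ∃ D : complexBetti B.X 2, D ∈ hodgeClassSpan B.dim B.X 1 ∧ lefschetzPow D (B.dim - 1) 2 D ≠ 0 ∧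
      (∀ z : complexBetti B.X 1, (∀ y, polarizationPairingOne B.X D (B.dim - 1) z y = 0) → z = 0) ∧
      ∀ (a : ℕ) (y : complexBetti B.X (2 * a)), (∀ u ∈ unitaryCentralizerGroup B D,
        exteriorPullback (AbelianVariety.hasExteriorCohomologyH1_complexPoints B)
          (u : complexBetti B.X 1 →ₗ[ℂ] complexBetti B.X 1) (2 * a) y = y) → y ∈ divisorClassesSpan B.X B.dim a)
    (hC : ∃ D : complexBetti C.X 2, D ∈ hodgeClassSpan C.dim C.X 1 ∧ lefschetzPow D (C.dim - 1) 2 D ≠ 0 ∧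
      (∀ z : complexBetti C.X 1, (∀ y, polarizationPairingOne C.X D (C.dim - 1) z y = 0) → z = 0) ∧
      ∀ (a : ℕ) (y : complexBetti C.X (2 * a)), (∀ u ∈ unitaryCentralizerGroup C D,
        exteriorPullback (AbelianVariety.hasExteriorCohomologyH1_complexPoints C)
          (u : complexBetti C.X 1 →ₗ[ℂ] complexBetti C.X 1) (2 * a) y = y) → y ∈ divisorClassesSpan C.X C.dim a)
    (p : ℕ) (x : complexBetti X.X (2 * p)) (hx : ∀ g ∈ specialLefschetzGroup X.dim X.X, g (2 * p) x = x) :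
    x ∈ divisorClassesSpan X.X X.dim p :=
  specialLefschetzGroup_invariants_le_of_isIsogenous_of_exists hX (by rw [AbelianVariety.dim_prod]; omega)
    (exists_polarization_invariants_le_prod hBC hCB hB0 hC0 hB hC) p x hx

end Packages

/-! ### §4 New loci of the record, hypotheses closed -/

section Loci

variable {n : ℕ} {A : Fin (n + 1) → AbelianVariety ℂ} {X : AbelianVariety ℂ}

/-- **Milne 1999, Cor. 4.5 (with Thm. 4.4 and Thm. 3.2) for every complex abelian variety isogenous to a finite
product `⨁ Aᵢ` of pairwise `Hom`-orthogonal positive-dimensional factors, each with commutative `End(Aᵢ)` or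
with `B(Aᵢ) = D(Aᵢ)`**: every class of `H^{2p}(X(ℂ); ℂ)` fixed by `specialLefschetzGroup (dim X) X.X` lies in
`Dᵖ_hom(X)_ℂ`. [cite: Milne1999LefschetzClasses, Prop. 3.4 (start of proof, p. 654), Thm. 3.2, Cor. 4.5 (p. 659)] -/
theorem specialLefschetzGroup_invariants_le_of_isIsogenous_biproduct (hX : AbelianVariety.IsIsogenous X (⨁ A))
    (hOrth : ∀ i j, i ≠ j → ∀ f : A i ⟶ A j, f = 0) (h0 : ∀ i, 0 < (A i).dim)
    (hA : ∀ i, (∀ φ ψ : A i ⟶ A i, φ ≫ ψ = ψ ≫ φ) ∨ IsDivisorGenerated (A i))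
    (p : ℕ) (x : complexBetti X.X (2 * p)) (hx : ∀ g ∈ specialLefschetzGroup X.dim X.X, g (2 * p) x = x) :
    x ∈ divisorClassesSpan X.X X.dim p :=
  specialLefschetzGroup_invariants_le_of_isIsogenous_biproduct_of_forall_exists hX hOrth h0
    (fun i ↦ exists_polarization_invariants_le_of_forall_comp_comm_or_isDivisorGenerated (h0 i) (hA i)) p x hx

/-- **The same on the product `⨁ Aᵢ` itself.** [cite: Milne1999LefschetzClasses, Prop. 3.4 (p. 654), Cor. 4.5 (p. 659)] -/
theorem specialLefschetzGroup_invariants_le_biproduct (hOrth : ∀ i j, i ≠ j → ∀ f : A i ⟶ A j, f = 0)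
    (h0 : ∀ i, 0 < (A i).dim) (hA : ∀ i, (∀ φ ψ : A i ⟶ A i, φ ≫ ψ = ψ ≫ φ) ∨ IsDivisorGenerated (A i))
    (p : ℕ) (x : complexBetti (⨁ A).X (2 * p))
    (hx : ∀ g ∈ specialLefschetzGroup (⨁ A).dim (⨁ A).X, g (2 * p) x = x) :
    x ∈ divisorClassesSpan (⨁ A).X (⨁ A).dim p :=
  specialLefschetzGroup_invariants_le_of_isIsogenous_biproduct (AbelianVariety.IsIsogenous.refl _) hOrth h0 hA p x
    hx

/-- **Pairwise non-isogenous SIMPLE factors** (Milne's `A₁ × ⋯ × A_s` with all `rᵢ = 1`): every complex abelian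
variety isogenous to a product of pairwise non-isogenous simple positive-dimensional abelian varieties, each
with commutative `End` (types I and IV with `d = 1`) or with `B = D` (e.g. of dimension `≤ 3`), satisfies the
conclusion of the record; `Hom(Aᵢ, Aⱼ) = 0` for `i ≠ j` is Mumford §19 Cor. 2
(`orthogonal_of_isSimple_of_not_isIsogenous`). [cite: Milne1999LefschetzClasses, Prop. 3.4 (p. 654), Thm. 3.2, Cor. 4.5]
[cite: MumfordAV1970, §19 Cor. 2 of Thm. 1 (p. 174)] -/
theorem specialLefschetzGroup_invariants_le_of_isIsogenous_biproduct_of_isSimple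
    (hX : AbelianVariety.IsIsogenous X (⨁ A)) (hS : ∀ i, AbelianVariety.IsSimple (A i))
    (hni : ∀ i j, i ≠ j → ¬ AbelianVariety.IsIsogenous (A i) (A j)) (h0 : ∀ i, 0 < (A i).dim)
    (hA : ∀ i, (∀ φ ψ : A i ⟶ A i, φ ≫ ψ = ψ ≫ φ) ∨ IsDivisorGenerated (A i))
    (p : ℕ) (x : complexBetti X.X (2 * p)) (hx : ∀ g ∈ specialLefschetzGroup X.dim X.X, g (2 * p) x = x) :
    x ∈ divisorClassesSpan X.X X.dim p :=
  specialLefschetzGroup_invariants_le_of_isIsogenous_biproduct hX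
    (AbelianVariety.orthogonal_of_isSimple_of_not_isIsogenous hS hni) h0 hA p x hx

/-- **Cor. 4.5 as an equality of sets** on this locus. [cite: Milne1999LefschetzClasses, Cor. 4.5 (p. 659)] -/
theorem setOf_forall_apply_eq_self_eq_divisorClassesSpan_of_isIsogenous_biproduct'
    (hX : AbelianVariety.IsIsogenous X (⨁ A)) (hOrth : ∀ i j, i ≠ j → ∀ f : A i ⟶ A j, f = 0)
    (h0 : ∀ i, 0 < (A i).dim) (hA : ∀ i, (∀ φ ψ : A i ⟶ A i, φ ≫ ψ = ψ ≫ φ) ∨ IsDivisorGenerated (A i))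
    (p : ℕ) :
    {x : complexBetti X.X (2 * p) | ∀ g ∈ specialLefschetzGroup X.dim X.X, g (2 * p) x = x} =
      (divisorClassesSpan X.X X.dim p : Set _) :=
  setOf_forall_apply_eq_self_eq_divisorClassesSpan_of_isIsogenous_biproduct hX hOrth h0
    (fun i ↦ exists_polarization_invariants_le_of_forall_comp_comm_or_isDivisorGenerated (h0 i) (hA i)) p

/-- **Milne Prop. 4.8, (c) ⇒ (a), record-free** on this locus: `Hg′(X) = S(X) ⟹ B(X) = D(X)`.
[cite: Milne1999LefschetzClasses, Prop. 4.8 and Cor. 4.5 (pp. 659–660)] -/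
theorem isDivisorGenerated_of_hodgeGroup_eq_specialLefschetzGroup_of_isIsogenous_biproduct'
    (hX : AbelianVariety.IsIsogenous X (⨁ A)) (hOrth : ∀ i j, i ≠ j → ∀ f : A i ⟶ A j, f = 0)
    (h0 : ∀ i, 0 < (A i).dim) (hA : ∀ i, (∀ φ ψ : A i ⟶ A i, φ ≫ ψ = ψ ≫ φ) ∨ IsDivisorGenerated (A i))
    (hHg : hodgeGroup X.dim X.X = specialLefschetzGroup X.dim X.X) :
    IsDivisorGenerated X :=
  isDivisorGenerated_of_hodgeGroup_eq_specialLefschetzGroup_of_isIsogenous_biproduct hX hOrth h0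
    (fun i ↦ exists_polarization_invariants_le_of_forall_comp_comm_or_isDivisorGenerated (h0 i) (hA i)) hHg

/-- **A power of a simple CM abelian variety times a packaged complement**: for `S` simple of CM type with
`0 < dim S`, `C` positive-dimensional with commutative `End` or `B(C) = D(C)`, and
`Hom(S^{N+1}, C) = 0 = Hom(C, S^{N+1})`, every `X` isogenous onto `S^{N+1} × C` satisfies the conclusion of the
record (Milne's `A₁^{r₁} × A₂` with `A₁` of CM type). [cite: Milne1999LefschetzClasses, Prop. 3.4 (p. 654), Thm. 3.2, Lemma 3.8, Cor. 4.5]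
[cite: Milne1999, §2 p. 54] -/
theorem specialLefschetzGroup_invariants_le_of_isIsogenous_powSucc_prod {S C : AbelianVariety ℂ} {N : ℕ}
    (hX : AbelianVariety.IsIsogenous X ((S.powSucc N).prod C)) (hSs : AbelianVariety.IsSimple S) (hS0 : 0 < S.dim)
    (hCM : IsOfCMType S) (hC0 : 0 < C.dim) (hSC : ∀ f : S.powSucc N ⟶ C, f = 0) (hCS : ∀ g : C ⟶ S.powSucc N, g = 0)
    (hC : (∀ φ ψ : C ⟶ C, φ ≫ ψ = ψ ≫ φ) ∨ IsDivisorGenerated C)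
    (p : ℕ) (x : complexBetti X.X (2 * p)) (hx : ∀ g ∈ specialLefschetzGroup X.dim X.X, g (2 * p) x = x) :
    x ∈ divisorClassesSpan X.X X.dim p := by
  have hP0 : 0 < (S.powSucc N).dim := by
    obtain ⟨f, hf⟩ := isIsogenous_powSucc_biproduct S N
    rw [AbelianVariety.dim_eq_of_isIsogeny hf]
    exact dim_biproduct_pos _ hS0
  exact specialLefschetzGroup_invariants_le_of_isIsogenous_prod_of_exists hX hSC hCS hP0 hC0
    (exists_polarization_invariants_le_powSucc_of_isSimple_of_isOfCMType hSs hS0 hCM N)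
    (exists_polarization_invariants_le_of_forall_comp_comm_or_isDivisorGenerated hC0 hC) p x hx

/-- Multiplicity bookkeeping (private): a package of `T` packages the one-fold biproduct `⨁_{Fin (N+1)} T`
when `N = 0` (transport along the isomorphism `π₀`). [folklore] -/
private theorem exists_polarization_invariants_le_biproduct_const_of_eq_zero {N : ℕ} (hN : N = 0)
    {T : AbelianVariety ℂ}
    (hT : ∃ D : complexBetti T.X 2, D ∈ hodgeClassSpan T.dim T.X 1 ∧ lefschetzPow D (T.dim - 1) 2 D ≠ 0 ∧
      (∀ z : complexBetti T.X 1, (∀ y, polarizationPairingOne T.X D (T.dim - 1) z y = 0) → z = 0) ∧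
      ∀ (a : ℕ) (y : complexBetti T.X (2 * a)), (∀ u ∈ unitaryCentralizerGroup T D,
        exteriorPullback (AbelianVariety.hasExteriorCohomologyH1_complexPoints T)
          (u : complexBetti T.X 1 →ₗ[ℂ] complexBetti T.X 1) (2 * a) y = y) → y ∈ divisorClassesSpan T.X T.dim a) :
    ∃ D : complexBetti (⨁ fun _ : Fin (N + 1) => T).X 2,
      D ∈ hodgeClassSpan (⨁ fun _ : Fin (N + 1) => T).dim (⨁ fun _ : Fin (N + 1) => T).X 1 ∧
      lefschetzPow D ((⨁ fun _ : Fin (N + 1) => T).dim - 1) 2 D ≠ 0 ∧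
      (∀ z : complexBetti (⨁ fun _ : Fin (N + 1) => T).X 1,
        (∀ y, polarizationPairingOne (⨁ fun _ : Fin (N + 1) => T).X D ((⨁ fun _ : Fin (N + 1) => T).dim - 1) z y =
          0) → z = 0) ∧
      ∀ (a : ℕ) (y : complexBetti (⨁ fun _ : Fin (N + 1) => T).X (2 * a)),
        (∀ u ∈ unitaryCentralizerGroup (⨁ fun _ : Fin (N + 1) => T) D,
          exteriorPullback (AbelianVariety.hasExteriorCohomologyH1_complexPoints (⨁ fun _ : Fin (N + 1) => T))
            (u : complexBetti (⨁ fun _ : Fin (N + 1) => T).X 1 →ₗ[ℂ] complexBetti (⨁ fun _ : Fin (N + 1) => T).X 1)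
            (2 * a) y = y) →
        y ∈ divisorClassesSpan (⨁ fun _ : Fin (N + 1) => T).X (⨁ fun _ : Fin (N + 1) => T).dim a := by
  subst hN
  exact exists_polarization_invariants_le_of_isIsogeny (isIsogeny_biproduct_π_fin_one fun _ : Fin (0 + 1) => T) hT

/-- **Milne 1999, Thm. 3.2 / Cor. 4.5 in the shape of Prop. 1.1 — `X ∼ A₁^{r₁} × ⋯ × A_s^{r_s}` with the `Aᵢ`
simple and pairwise non-isogenous — on the proved locus**: let `X` be isogenous onto
`⨁ᵢ ⨁_{Fin (rᵢ+1)} Sᵢ` with `S₀, …, S_m` simple, positive-dimensional and pairwise non-isogenous, where every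
`Sᵢ` is EITHER of CM type (any multiplicity `rᵢ + 1`: the torus argument with multiplicities, Lemma 3.8) OR
occurs with multiplicity one (`rᵢ = 0`) and has commutative `End(Sᵢ)` (types I and IV with `d = 1`) or
`B(Sᵢ) = D(Sᵢ)`. Then every class of `H^{2p}(X(ℂ); ℂ)` fixed by `specialLefschetzGroup (dim X) X.X` lies in
`Dᵖ_hom(X)_ℂ`. (`Hom` between the isotypic blocks vanishes: `hom_biproduct_eq_zero` with Mumford §19 Cor. 2.)
What is excluded is exactly the range of Prop. 3.6 / 3.7 that the tree lacks: non-CM isotypic blocks of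
multiplicity `≥ 2`, and simple factors of types II, III, IV (`d ≥ 2`) with `B ≠ D`.
[cite: Milne1999LefschetzClasses, Prop. 1.1 (p. 643), Thm. 3.2, Prop. 3.4 (start of proof, p. 654), Lemma 3.8, Cor. 4.5 (p. 659)]
[cite: MumfordAV1970, §19 Thm. 1, Cor. 1–2 (pp. 173–174)] -/
theorem specialLefschetzGroup_invariants_le_of_isIsogenous_biproduct_isotypic {m : ℕ}
    {S : Fin (m + 1) → AbelianVariety ℂ} {r : Fin (m + 1) → ℕ}
    (hX : AbelianVariety.IsIsogenous X (⨁ fun i => ⨁ fun _ : Fin (r i + 1) => S i))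
    (hS : ∀ i, AbelianVariety.IsSimple (S i)) (hni : ∀ i j, i ≠ j → ¬ AbelianVariety.IsIsogenous (S i) (S j))
    (h0 : ∀ i, 0 < (S i).dim)
    (hkind : ∀ i, IsOfCMType (S i) ∨
      (r i = 0 ∧ ((∀ φ ψ : S i ⟶ S i, φ ≫ ψ = ψ ≫ φ) ∨ IsDivisorGenerated (S i))))
    (p : ℕ) (x : complexBetti X.X (2 * p)) (hx : ∀ g ∈ specialLefschetzGroup X.dim X.X, g (2 * p) x = x) :
    x ∈ divisorClassesSpan X.X X.dim p :=
  specialLefschetzGroup_invariants_le_of_isIsogenous_biproduct_of_forall_exists hX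
    (fun i j hij F ↦ AbelianVariety.hom_biproduct_eq_zero
      (fun _ _ f ↦ AbelianVariety.orthogonal_of_isSimple_of_not_isIsogenous hS hni i j hij f) F)
    (fun i ↦ dim_biproduct_pos (fun _ : Fin (r i + 1) => S i) (h0 i))
    (fun i ↦ (hkind i).elim
      (fun hCM ↦ exists_polarization_invariants_le_of_isIsogenous' (isIsogenous_powSucc_biproduct (S i) (r i))
        (exists_polarization_invariants_le_powSucc_of_isSimple_of_isOfCMType (hS i) (h0 i) hCM (r i)))
      fun h ↦ exists_polarization_invariants_le_biproduct_const_of_eq_zero h.1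
        (exists_polarization_invariants_le_of_forall_comp_comm_or_isDivisorGenerated (h0 i) h.2))
    p x hx

/-- **The same on the product `⨁ᵢ ⨁_{Fin (rᵢ+1)} Sᵢ` itself.** [cite: Milne1999LefschetzClasses, Thm. 3.2, Prop. 3.4 (p. 654), Cor. 4.5 (p. 659)] -/
theorem specialLefschetzGroup_invariants_le_biproduct_isotypic {m : ℕ} {S : Fin (m + 1) → AbelianVariety ℂ}
    {r : Fin (m + 1) → ℕ} (hS : ∀ i, AbelianVariety.IsSimple (S i))
    (hni : ∀ i j, i ≠ j → ¬ AbelianVariety.IsIsogenous (S i) (S j)) (h0 : ∀ i, 0 < (S i).dim)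
    (hkind : ∀ i, IsOfCMType (S i) ∨
      (r i = 0 ∧ ((∀ φ ψ : S i ⟶ S i, φ ≫ ψ = ψ ≫ φ) ∨ IsDivisorGenerated (S i))))
    (p : ℕ) (x : complexBetti (⨁ fun i => ⨁ fun _ : Fin (r i + 1) => S i).X (2 * p))
    (hx : ∀ g ∈ specialLefschetzGroup (⨁ fun i => ⨁ fun _ : Fin (r i + 1) => S i).dim
      (⨁ fun i => ⨁ fun _ : Fin (r i + 1) => S i).X, g (2 * p) x = x) :
    x ∈ divisorClassesSpan (⨁ fun i => ⨁ fun _ : Fin (r i + 1) => S i).X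
      (⨁ fun i => ⨁ fun _ : Fin (r i + 1) => S i).dim p :=
  specialLefschetzGroup_invariants_le_of_isIsogenous_biproduct_isotypic (AbelianVariety.IsIsogenous.refl _) hS hni
    h0 hkind p x hx

/-- **Cor. 4.5 as an equality of sets** on this locus. [cite: Milne1999LefschetzClasses, Cor. 4.5 (p. 659)] -/
theorem setOf_forall_apply_eq_self_eq_divisorClassesSpan_of_isIsogenous_biproduct_isotypic {m : ℕ}
    {S : Fin (m + 1) → AbelianVariety ℂ} {r : Fin (m + 1) → ℕ}
    (hX : AbelianVariety.IsIsogenous X (⨁ fun i => ⨁ fun _ : Fin (r i + 1) => S i))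
    (hS : ∀ i, AbelianVariety.IsSimple (S i)) (hni : ∀ i j, i ≠ j → ¬ AbelianVariety.IsIsogenous (S i) (S j))
    (h0 : ∀ i, 0 < (S i).dim)
    (hkind : ∀ i, IsOfCMType (S i) ∨
      (r i = 0 ∧ ((∀ φ ψ : S i ⟶ S i, φ ≫ ψ = ψ ≫ φ) ∨ IsDivisorGenerated (S i))))
    (p : ℕ) :
    {x : complexBetti X.X (2 * p) | ∀ g ∈ specialLefschetzGroup X.dim X.X, g (2 * p) x = x} =
      (divisorClassesSpan X.X X.dim p : Set _) :=
  Set.Subset.antisymm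
    (fun x hx ↦ specialLefschetzGroup_invariants_le_of_isIsogenous_biproduct_isotypic hX hS hni h0 hkind p x hx)
    fun _ hx _ hg ↦ apply_eq_self_of_mem_specialLefschetzGroup hg hx

/-- **Milne Prop. 4.8, (c) ⇒ (a), record-free** on this locus: `Hg′(X) = S(X) ⟹ B(X) = D(X)`.
[cite: Milne1999LefschetzClasses, Prop. 4.8 and Cor. 4.5 (pp. 659–660)] -/
theorem isDivisorGenerated_of_hodgeGroup_eq_specialLefschetzGroup_of_isIsogenous_biproduct_isotypic {m : ℕ}
    {S : Fin (m + 1) → AbelianVariety ℂ} {r : Fin (m + 1) → ℕ}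
    (hX : AbelianVariety.IsIsogenous X (⨁ fun i => ⨁ fun _ : Fin (r i + 1) => S i))
    (hS : ∀ i, AbelianVariety.IsSimple (S i)) (hni : ∀ i j, i ≠ j → ¬ AbelianVariety.IsIsogenous (S i) (S j))
    (h0 : ∀ i, 0 < (S i).dim)
    (hkind : ∀ i, IsOfCMType (S i) ∨
      (r i = 0 ∧ ((∀ φ ψ : S i ⟶ S i, φ ≫ ψ = ψ ≫ φ) ∨ IsDivisorGenerated (S i))))
    (hHg : hodgeGroup X.dim X.X = specialLefschetzGroup X.dim X.X) :
    IsDivisorGenerated X :=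
  fun p c hc hpp ↦ specialLefschetzGroup_invariants_le_of_isIsogenous_biproduct_isotypic hX hS hni h0 hkind p c
    fun _ hg ↦ apply_eq_self_of_mem_hodgeGroup (hHg ▸ hg) hc hpp

end Loci

end Literature.AlgebraicGeometry.Milne1999

end
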